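import Summits.HodgeConjecture.HodgeConjecture.Theorems.LinearSystemTorelliTranscendentalOrSupportedStubPerpSubHodge

/-!
# Crux `TranscendentalOrSupported` (stmt-HodgeConjecture-10853), line `Sketch_chow_shadow` — stub
# `stub_imagePhantom`: the image of a rationally spanned sub-Hodge subspace without `(k,0)`-part
# under a rational type-`(0,0)` endomorphism

Helper file for the line skeleton (`Sketch_chow_shadow`, cohomological transcendental decomposition
of the diagonal) of the crux `TranscendentalOrSupported` of route `LinearSystemTorelli`
(GHC(2p, coniveau 1) in Grothendieck's sub-Hodge form), registered stub `stub_imagePhantom`.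
Notation: `X` a scheme over `ℂ`, `A` a Hodge model of `X` in dimension `n`
(`A.pullback k : Hᵏ(X(ℂ); ℂ) → Hᵏ(X^an; ℂ)` the bijective comparison, written `A^*`;
`A.hodgePQ k p' q'` the piece `H^{p',q'}` of the model), `k` a degree, `f` a `ℂ`-linear
endomorphism of `Hᵏ(X(ℂ); ℂ)`, and for a `ℂ`-subspace `V ⊆ Hᵏ(X(ℂ); ℂ)`:
* `V` is RATIONALLY SPANNED if `span ℂ {x ∈ V | x rational} = V` (`IsRationalClass`);
* `V` is SUB-HODGE (read in `A`) if `V.map A^* = ⨆_{p'+q'=k} V.map A^* ⊓ H^{p',q'}`;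
* `V` has NO `(k,0)`-PART if `V.map A^* ⊓ H^{k,0} = ⊥`.

CLAIM (`stub_imagePhantom`; Hodge-lattice algebra, Voisin I §7.3.1). Let `f` have Hodge bidegree
`(0,0)` read in `A` (`A^* c ∈ H^{p',q'} ⟹ A^* (f c) ∈ H^{p',q'}`) and map rational classes to
rational classes up to ONE non-zero scalar `u` (`c` rational ⟹ `f c = u • c'` with `c'` rational).
Then for every rationally spanned sub-Hodge `W ⊆ Hᵏ(X(ℂ); ℂ)` without `(k,0)`-part, the image
`f(W) = W.map f` is again rationally spanned, sub-Hodge, and without `(k,0)`-part.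

PROOF.
* (a) rationally spanned (`imagePhantom_span_isRationalClass_map`): `W = span {w ∈ W rational}`, so
  `f(W) = span (f '' {w ∈ W rational})` (`Submodule.map_span`), and for `w ∈ W` rational
  `f w = u • c'` with `c' = u⁻¹ • f w ∈ f(W)` rational, whence `f w ∈ span {x ∈ f(W) rational}`.
* (b) sub-Hodge (`imagePhantom_isSubHodge_map`): for `w ∈ W` decompose `w = Σ_{a+d=k} z(a,d)` with
  `A^* z(a,d) ∈ H^{a,d}` (`HodgeModel.exists_sum_eq_of_hodgeDecomposition`); the components
  `z(a,d)` lie in `W` (`perpSubHodge_component_mem`, landed with stub `stub_perpSubHodge`), so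
  `A^*(f w) = Σ A^*(f z(a,d))` with `A^*(f z(a,d)) ∈ f(W).map A^* ⊓ H^{a,d}`.
* (c) no `(k,0)`-part (`imagePhantom_map_inf_hodgePQ_eq_bot`): if `A^*(f w) ∈ H^{k,0}` for some
  `w ∈ W`, decompose `w` as in (b); `A^*(f w) = Σ A^*(f z(a,d))` and `A^*(f w)` is also its own
  one-term decomposition into types, so by uniqueness of the decomposition into Hodge types
  (`perpSubHodge_hodgeComponents_unique`) `A^*(f w) = A^*(f z(k,0))`; but
  `A^* z(k,0) ∈ W.map A^* ⊓ H^{k,0} = ⊥`, so `z(k,0) = 0` (`A^*` is injective) and `A^*(f w) = 0`.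

Pure tree theorems; no named fact is taken as a hypothesis and none is introduced. The hypothesis
`IsSmoothProjective n X` of the registered signature is not needed.

## References

* [VoisinHodgeI2002] C. Voisin, Hodge Theory and Complex Algebraic Geometry I, CUP 2002, §7.1.1
  (`Hᵏ(X, ℚ) ⊗ ℂ = Hᵏ(X, ℂ)`), §7.3.1 (morphisms of Hodge structures and sub-Hodge structures,
  Lemma 7.25 and the remark after Lemma 7.26), §6.1.3 Cor. 6.14 (a class of two types is zero).
* [GrothendieckTopology1969] A. Grothendieck, Hodge's general conjecture is false for trivial
  reasons, Topology 8 (1969), p. 300.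
-/

-- `Summit.HodgeConjecture.HodgeConjecture.Theorems` is the mandated namespace (single-conjunct summit:
-- Sub = Summit), which `linter.dupNamespace` flags on every declaration; the lakefile turns the
-- linter off tree-wide (weak option), restated here so stand-alone elaboration is warning-free too.
set_option linter.dupNamespace false

noncomputable section

namespace Summit.HodgeConjecture.HodgeConjecture.Theorems

open CategoryTheory
open Literature.AlgebraicGeometry.Motives Literature.AlgebraicGeometry.HodgeTheory
open Literature.AlgebraicTopology.SingularHomology
-- `Finset.antidiagonal` alone resolves to the `Set.IsPWO` antidiagonal of `Data.Finset.MulAntidiagonal`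
open Finset.HasAntidiagonal (antidiagonal mem_antidiagonal)

variable {n : ℕ} {X : SchemeOver ℂ}

/-! ### (a) The image of a rationally spanned subspace is rationally spanned -/

/-- **The image of a rationally spanned subspace under an endomorphism mapping rational classes to
rational classes up to one non-zero scalar is rationally spanned.** For a `ℂ`-linear endomorphism
`f` of `Hᵏ(X(ℂ); ℂ)`, a scalar `u ≠ 0` with `f c ∈ u • {rational classes}` for every rational `c`,
and `W = span ℂ {w ∈ W | w rational}`: `W.map f = span ℂ {x ∈ W.map f | x rational}`. Indeed
`W.map f = span (f '' {w ∈ W rational})` (`Submodule.map_span`), and for `w ∈ W` rational,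
`f w = u • c'` with `c' = u⁻¹ • f w ∈ W.map f` rational. [cite: VoisinHodgeI2002, §7.1.1 and §7.3.1] -/
theorem imagePhantom_span_isRationalClass_map {k : ℕ} (f : complexBetti X k →ₗ[ℂ] complexBetti X k)
    {u : ℂ} (hu : u ≠ 0)
    (hf : ∀ c : complexBetti X k, IsRationalClass c →
      ∃ c' : complexBetti X k, IsRationalClass c' ∧ f c = u • c')
    {W : Submodule ℂ (complexBetti X k)}
    (hW : Submodule.span ℂ {x : complexBetti X k | x ∈ W ∧ IsRationalClass x} = W) :
    Submodule.span ℂ {x : complexBetti X k | x ∈ W.map f ∧ IsRationalClass x} = W.map f := by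
  refine le_antisymm (Submodule.span_le.2 fun x hx ↦ hx.1) ?_
  calc W.map f ≤ (Submodule.span ℂ {x : complexBetti X k | x ∈ W ∧ IsRationalClass x}).map f :=
        Submodule.map_mono hW.ge
    _ ≤ Submodule.span ℂ {x : complexBetti X k | x ∈ W.map f ∧ IsRationalClass x} := by
        rw [Submodule.map_span, Submodule.span_le]
        rintro _ ⟨x, ⟨hxW, hxrat⟩, rfl⟩
        obtain ⟨c', hc', hfx⟩ := hf x hxrat
        -- `c' = u⁻¹ • f x ∈ W.map f` is rational
        have hc'W : c' ∈ W.map f := by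
          have h2 : u⁻¹ • f x ∈ W.map f := Submodule.smul_mem _ _ (Submodule.mem_map_of_mem hxW)
          rwa [hfx, smul_smul, inv_mul_cancel₀ hu, one_smul] at h2
        rw [SetLike.mem_coe, hfx]
        exact Submodule.smul_mem _ u (Submodule.subset_span ⟨hc'W, hc'⟩)

/-! ### (b) The image of a sub-Hodge subspace under a type-`(0,0)` endomorphism is sub-Hodge -/

/-- **The image of a sub-Hodge subspace under an endomorphism of Hodge bidegree `(0,0)` is a
sub-Hodge subspace.** For a Hodge model `A` of `X`, a `ℂ`-linear endomorphism `f` of `Hᵏ(X(ℂ); ℂ)`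
with `A^* c ∈ H^{p',q'} ⟹ A^*(f c) ∈ H^{p',q'}`, and `W ⊆ Hᵏ(X(ℂ); ℂ)` with
`W.map A^* = ⨆_{p'+q'=k} W.map A^* ⊓ H^{p',q'}`: the same holds for `W.map f`. The Hodge components
`z(a,d)` of `w ∈ W` (`HodgeModel.exists_sum_eq_of_hodgeDecomposition`) lie in `W`
(`perpSubHodge_component_mem`), so `A^*(f w) = Σ A^*(f z(a,d))` with
`A^*(f z(a,d)) ∈ (W.map f).map A^* ⊓ H^{a,d}`.
[cite: VoisinHodgeI2002, §7.3.1 (Lemma 7.25 and the remark after Lemma 7.26)] -/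
theorem imagePhantom_isSubHodge_map (A : HodgeModel n X) {k : ℕ}
    (f : complexBetti X k →ₗ[ℂ] complexBetti X k)
    (hf : ∀ ⦃p' q' : ℕ⦄ ⦃c : complexBetti X k⦄, A.pullback k c ∈ A.hodgePQ k p' q' →
      A.pullback k (f c) ∈ A.hodgePQ k p' q')
    {W : Submodule ℂ (complexBetti X k)}
    (hW : W.map (A.pullback k).hom =
      ⨆ (p' : ℕ) (q' : ℕ) (_ : p' + q' = k), W.map (A.pullback k).hom ⊓ A.hodgePQ k p' q') :
    (W.map f).map (A.pullback k).hom =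
      ⨆ (p' : ℕ) (q' : ℕ) (_ : p' + q' = k),
        (W.map f).map (A.pullback k).hom ⊓ A.hodgePQ k p' q' := by
  refine le_antisymm ?_ (iSup_le fun _ ↦ iSup_le fun _ ↦ iSup_le fun _ ↦ inf_le_left)
  rintro _ ⟨_, ⟨w, hw, rfl⟩, rfl⟩
  -- the Hodge components of `w` lie in `W`
  obtain ⟨z, hz, hzt⟩ := A.exists_sum_eq_of_hodgeDecomposition k w
  have hzW := perpSubHodge_component_mem A hW hw hz hzt
  have hsum : (A.pullback k).hom (f w) = ∑ i ∈ antidiagonal k, (A.pullback k).hom (f (z i)) := by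
    rw [← hz, map_sum, map_sum]
  rw [hsum]
  refine Submodule.sum_mem _ fun i hi ↦ ?_
  exact Submodule.mem_iSup_of_mem i.1 (Submodule.mem_iSup_of_mem i.2
    (Submodule.mem_iSup_of_mem (mem_antidiagonal.1 hi)
      ⟨Submodule.mem_map_of_mem (Submodule.mem_map_of_mem (hzW i hi)), hf (hzt i hi)⟩))

/-! ### (c) The image keeps having no `(k,0)`-part -/

/-- **No `(k,0)`-part is preserved.** For a Hodge model `A` of `X`, a `ℂ`-linear endomorphism `f`
of `Hᵏ(X(ℂ); ℂ)` of Hodge bidegree `(0,0)` read in `A`, and `W ⊆ Hᵏ(X(ℂ); ℂ)` sub-Hodge (read in `A`)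
with `W.map A^* ⊓ H^{k,0} = ⊥`: also `(W.map f).map A^* ⊓ H^{k,0} = ⊥`. If `A^*(f w) ∈ H^{k,0}` for
`w ∈ W` with Hodge components `z(a,d) ∈ W` (`HodgeModel.exists_sum_eq_of_hodgeDecomposition`,
`perpSubHodge_component_mem`), then `A^*(f w) = Σ A^*(f z(a,d))` is a decomposition into types and
`A^*(f w)` is its own one-term decomposition, so `A^*(f w) = A^*(f z(k,0))` by uniqueness
(`perpSubHodge_hodgeComponents_unique`); and `A^* z(k,0) ∈ W.map A^* ⊓ H^{k,0} = ⊥` forces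
`z(k,0) = 0` (`A^*` is injective). [cite: VoisinHodgeI2002, §7.3.1 and Cor. 6.14] -/
theorem imagePhantom_map_inf_hodgePQ_eq_bot (A : HodgeModel n X) {k : ℕ}
    (f : complexBetti X k →ₗ[ℂ] complexBetti X k)
    (hf : ∀ ⦃p' q' : ℕ⦄ ⦃c : complexBetti X k⦄, A.pullback k c ∈ A.hodgePQ k p' q' →
      A.pullback k (f c) ∈ A.hodgePQ k p' q')
    {W : Submodule ℂ (complexBetti X k)}
    (hW : W.map (A.pullback k).hom =
      ⨆ (p' : ℕ) (q' : ℕ) (_ : p' + q' = k), W.map (A.pullback k).hom ⊓ A.hodgePQ k p' q')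
    (hW0 : W.map (A.pullback k).hom ⊓ A.hodgePQ k k 0 = ⊥) :
    (W.map f).map (A.pullback k).hom ⊓ A.hodgePQ k k 0 = ⊥ := by
  rw [eq_bot_iff]
  rintro _ ⟨⟨_, ⟨w, hw, rfl⟩, rfl⟩, hy⟩
  rw [Submodule.mem_bot]
  -- the Hodge components of `w` lie in `W`
  obtain ⟨z, hz, hzt⟩ := A.exists_sum_eq_of_hodgeDecomposition k w
  have hzW := perpSubHodge_component_mem A hW hw hz hzt
  have hk0 : ((k, 0) : ℕ × ℕ) ∈ antidiagonal k := mem_antidiagonal.2 (Nat.add_zero k)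
  -- the `(k,0)`-component of `w` vanishes: `A^* z(k,0) ∈ W.map A^* ⊓ H^{k,0} = ⊥`
  have hz0 : z (k, 0) = 0 := by
    have hmem : (A.pullback k).hom (z (k, 0)) ∈ W.map (A.pullback k).hom ⊓ A.hodgePQ k k 0 :=
      ⟨Submodule.mem_map_of_mem (hzW (k, 0) hk0), hzt (k, 0) hk0⟩
    rw [hW0, Submodule.mem_bot] at hmem
    exact A.pullback_injective k (by rw [map_zero]; exact hmem)
  -- two decompositions of `A^*(f w)` into Hodge types: `Σ A^*(f z(a,d))` and the one-term one
  have hv : ∀ i ∈ antidiagonal k, (A.pullback k).hom (f (z i)) ∈ A.hodgePQ k i.1 i.2 :=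
    fun i hi ↦ hf (hzt i hi)
  have hw' : ∀ i ∈ antidiagonal k,
      (Pi.single (k, 0) ((A.pullback k).hom (f w)) : ℕ × ℕ → singularCohomology ℂ ℂ A.carrier k) i ∈
        A.hodgePQ k i.1 i.2 := by
    intro i _
    by_cases h : i = (k, 0)
    · subst h
      rw [Pi.single_eq_same]
      exact hy
    · rw [Pi.single_eq_of_ne h]
      exact Submodule.zero_mem _
  have hsum : ∑ i ∈ antidiagonal k, (A.pullback k).hom (f (z i)) =
      ∑ i ∈ antidiagonal k,
        (Pi.single (k, 0) ((A.pullback k).hom (f w)) : ℕ × ℕ → singularCohomology ℂ ℂ A.carrier k) i := by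
    rw [Finset.sum_pi_single' (k, 0) ((A.pullback k).hom (f w)) (antidiagonal k), if_pos hk0,
      ← map_sum, ← map_sum, hz]
  have hcomp : (A.pullback k).hom (f (z (k, 0))) =
      (Pi.single (k, 0) ((A.pullback k).hom (f w)) : ℕ × ℕ → singularCohomology ℂ ℂ A.carrier k)
        (k, 0) :=
    perpSubHodge_hodgeComponents_unique A k hv hw' hsum (k, 0) hk0
  rw [Pi.single_eq_same] at hcomp
  rw [← hcomp, hz0, map_zero, map_zero]

/-! ### The stub -/

/-- **STUB `stub_imagePhantom` of the crux `TranscendentalOrSupported`, line `Sketch_chow_shadow`**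
(lattice algebra of Hodge structures, Voisin I §7.3.1): for a Hodge model `A` of `X`, an
endomorphism `f` of `Hᵏ(X(ℂ); ℂ)` of Hodge bidegree `(0,0)` read in `A` that maps rational classes
to rational classes up to ONE non-zero scalar `u`, and a rationally spanned `W ⊆ Hᵏ(X(ℂ); ℂ)` whose
pull-back to `A` is a sub-Hodge structure WITHOUT `(k,0)`-part, the image `f(W) = W.map f` has the
same three properties: it is spanned by the rational classes `u⁻¹ • f w`, `w ∈ W` rational
(`imagePhantom_span_isRationalClass_map`); the Hodge components of `A^*(f w) = Σ A^*(f z(a,d))` lie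
in `A^*(f W)` (`imagePhantom_isSubHodge_map`); and an element of `A^*(f W) ⊓ H^{k,0}` is
`A^*(f z(k,0))` with `A^* z(k,0) ∈ A^* W ⊓ H^{k,0} = ⊥` (`imagePhantom_map_inf_hodgePQ_eq_bot`).
The hypothesis `IsSmoothProjective n X` is not needed.
[cite: VoisinHodgeI2002, §7.3.1 (Lemma 7.25 and the remark after Lemma 7.26) and Cor. 6.14] -/
theorem stub_imagePhantom :
    ∀ ⦃n : ℕ⦄ ⦃X : SchemeOver ℂ⦄ (hX : IsSmoothProjective n X) (A : HodgeModel n X) ⦃k : ℕ⦄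
    (f : complexBetti X k →ₗ[ℂ] complexBetti X k),
    (∀ ⦃p' q' : ℕ⦄ ⦃c : complexBetti X k⦄, A.pullback k c ∈ A.hodgePQ k p' q' →
      A.pullback k (f c) ∈ A.hodgePQ k p' q') →
    (∃ u : ℂ, u ≠ 0 ∧ ∀ c : complexBetti X k, IsRationalClass c →
      ∃ c' : complexBetti X k, IsRationalClass c' ∧ f c = u • c') →
    ∀ (W : Submodule ℂ (complexBetti X k)),
    Submodule.span ℂ {x : complexBetti X k | x ∈ W ∧ IsRationalClass x} = W →
    W.map (A.pullback k).hom =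
      ⨆ (p' : ℕ) (q' : ℕ) (_ : p' + q' = k), W.map (A.pullback k).hom ⊓ A.hodgePQ k p' q' →
    W.map (A.pullback k).hom ⊓ A.hodgePQ k k 0 = ⊥ →
    Submodule.span ℂ {x : complexBetti X k | x ∈ W.map f ∧ IsRationalClass x} = W.map f ∧
    (W.map f).map (A.pullback k).hom =
      ⨆ (p' : ℕ) (q' : ℕ) (_ : p' + q' = k), (W.map f).map (A.pullback k).hom ⊓ A.hodgePQ k p' q' ∧
    (W.map f).map (A.pullback k).hom ⊓ A.hodgePQ k k 0 = ⊥ := by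
  intro n X _ A k f hf hu W hWrat hWsub hW0
  obtain ⟨u, hu0, hu⟩ := hu
  exact ⟨imagePhantom_span_isRationalClass_map f hu0 hu hWrat, imagePhantom_isSubHodge_map A f hf hWsub,
    imagePhantom_map_inf_hodgePQ_eq_bot A f hf hWsub hW0⟩

end Summit.HodgeConjecture.HodgeConjecture.Theorems

end
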